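import Mathlib
import Summits.ValiantsHypothesis.ValiantsHypothesis.Theorems.NewtonUnitEquationsDissociatedUniformQuasiPoly
import Summits.ValiantsHypothesis.ValiantsHypothesis.Theorems.NewtonUnitEquationsDissociatedFixedKThickness

/-!
# Crux `NewtonUnitEquations.DissociatedUniform` (stmt-ValiantsHypothesis-5905), line `greedy-basis-shadow` —
# stub `stub_torusDepth` (torus frames: greedy words have depth `< k`)

Setting: a frame `A : Fin m → Finset ℕ²` with coefficient polynomials `f i j`, a chart height
`h b = ε · Xf b + λ · Yf b` injective on the box `piFinset A`, the letterwise `h`-top word `τ` (`hτ`, `hτA`) and a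
word `a` that is lex-greedy for `h` (`a ∈ QuasiPoly.gE (piFinset A) (col f) h`: `col f a` is not in the span of the
columns of the strictly higher box words).  On a TORUS frame (`htorus`: no coefficient of an alphabet letter
vanishes) `a` differs from `τ` in at most `k - 1` coordinates.

Proof.  Let `J := {j | a j ≠ τ j}`.  Greedy gives a linear functional `ψ` on `ℂ^k` with `ψ (col f a) ≠ 0` killing the
span `W` of the higher columns (`Submodule.exists_dual_map_eq_bot_of_notMem`); write `ψ v = ∑ i, ψc i * v i`.  On the
two-letter sub-cube `Π_{j ∈ J} {a j, τ j} × Π_{j ∉ J} {a j}` every corner word other than `a` lies in the box, is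
letterwise `h`-≥ `a` (heights are additive over letters, `hτ`) and `≠ a`, hence strictly higher (`hinj`), so `ψ` kills
its column; the corner `a` survives.  With `x i := ψc i * ∏_{j ∉ J} coeff (a j) (f i j)` and
`φ i j b := coeff (cond b (a j) (τ j)) (f i j)` this is exactly the input of the tree lemma
`DissociatedFixedK.thickness_of_annihilator` (file `NewtonUnitEquationsDissociatedFixedKThickness.lean`), whose
trichotomy hypothesis holds through its middle alternative `coeff (τ j) (f i j) ≠ 0` (torus); it returns `|J| < k`.
The fit is the one of `DissociatedFixedK.stub_thicknessFit` with `ψ ∘ col f` in place of the scalar tensor value.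
[folklore]
-/

open scoped BigOperators

-- Sub = Summit single-conjunct layout: the duplicated namespace component is mandated by the tree.
set_option linter.dupNamespace false

namespace Summit.ValiantsHypothesis.ValiantsHypothesis.Theorems.NewtonUnitEquationsDissociatedUniform

/-- **Torus depth** (registered stub `stub_torusDepth` of line `greedy-basis-shadow`).  On a torus frame (no
coefficient of a letter of the alphabet vanishes), a word `a` that is lex-greedy for an injective chart height
`b ↦ ε · Xf b + λ · Yf b` differs from the letterwise top word `τ` in at most `k - 1` coordinates: the annihilating
product functional of `DissociatedFixedK.thickness_of_annihilator`, fed with a linear functional separating `col f a`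
from the span of the higher columns. [folklore] -/
theorem stub_torusDepth (k m : ℕ) (A : Fin m → Finset (Fin 2 →₀ ℕ)) (f : Fin k → Fin m → MvPolynomial (Fin 2) ℂ)
    (ε lam : ℝ) (τ a : Fin m → (Fin 2 →₀ ℕ))
    (htorus : ∀ i j, ∀ l ∈ A j, (f i j).coeff l ≠ 0) (hτA : ∀ j, τ j ∈ A j)
    (hτ : ∀ j, ∀ l ∈ A j, ε * ((l 0 : ℕ) : ℝ) + lam * ((l 1 : ℕ) : ℝ) ≤ ε * ((τ j 0 : ℕ) : ℝ) + lam * ((τ j 1 : ℕ) : ℝ))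
    (hinj : Set.InjOn (fun b : Fin m → (Fin 2 →₀ ℕ) => ε * QuasiPoly.Xf b + lam * QuasiPoly.Yf b) (Fintype.piFinset A))
    (ha : a ∈ QuasiPoly.gE (Fintype.piFinset A) (QuasiPoly.col f)
      (fun b : Fin m → (Fin 2 →₀ ℕ) => ε * QuasiPoly.Xf b + lam * QuasiPoly.Yf b)) :
    (Finset.univ.filter fun j => a j ≠ τ j).card + 1 ≤ k := by
  classical
  -- the height is additive over the letters of a word
  have hadd : ∀ b : Fin m → (Fin 2 →₀ ℕ), ε * QuasiPoly.Xf b + lam * QuasiPoly.Yf b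
      = ∑ j, (ε * ((b j 0 : ℕ) : ℝ) + lam * ((b j 1 : ℕ) : ℝ)) := by
    intro b
    simp only [QuasiPoly.Xf, QuasiPoly.Yf, Finsupp.coe_finsetSum, Finset.sum_apply, Nat.cast_sum,
      Finset.mul_sum, Finset.sum_add_distrib]
  obtain ⟨haA, hnot⟩ := ha
  have haA' : ∀ j, a j ∈ A j := Fintype.mem_piFinset.mp haA
  -- a linear functional separating `col f a` from the span `W` of the higher columns
  obtain ⟨ψ, hψa, hψW⟩ := Submodule.exists_dual_map_eq_bot_of_notMem hnot inferInstance
  have hψkill : ∀ b ∈ Fintype.piFinset A,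
      ε * QuasiPoly.Xf a + lam * QuasiPoly.Yf a < ε * QuasiPoly.Xf b + lam * QuasiPoly.Yf b →
      ψ (QuasiPoly.col f b) = 0 := by
    intro b hb hlt
    rw [← LinearMap.le_ker_iff_map] at hψW
    exact LinearMap.mem_ker.mp (hψW (Submodule.subset_span ⟨b, ⟨hb, hlt⟩, rfl⟩))
  -- coordinates of `ψ`
  let ψc : Fin k → ℂ := fun i => ψ fun i' => if i = i' then 1 else 0
  have hψsum : ∀ v : Fin k → ℂ, ψ v = ∑ i, ψc i * v i := by
    intro v
    rw [LinearMap.pi_apply_eq_sum_univ ψ v]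
    refine Finset.sum_congr rfl fun i _ => ?_
    rw [smul_eq_mul, mul_comm]
  -- the deviation set and the sub-cube data (`true ↦ a j`, `false ↦ τ j`)
  set J : Finset (Fin m) := Finset.univ.filter fun j => a j ≠ τ j with hJ
  let x : Fin k → ℂ := fun i => ψc i * ∏ j ∈ Jᶜ, (f i j).coeff (a j)
  let φ : Fin k → ↥J → Bool → ℂ := fun i j y => (f i j).coeff (cond y (a j) (τ j))
  -- the word of a cube corner
  let wd : (↥J → Bool) → Fin m → (Fin 2 →₀ ℕ) := fun y j =>
    if hj : j ∈ J then cond (y ⟨j, hj⟩) (a j) (τ j) else a j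
  have hwdA : ∀ y, wd y ∈ Fintype.piFinset A := by
    intro y
    refine Fintype.mem_piFinset.mpr fun j => ?_
    simp only [wd]
    split_ifs with hj
    · rcases Bool.eq_false_or_eq_true (y ⟨j, hj⟩) with hy | hy
      · rw [hy]; exact haA' j
      · rw [hy]; exact hτA j
    · exact haA' j
  -- `ψ` of the column of a corner word = the cube expression
  have hT : ∀ y, ψ (QuasiPoly.col f (wd y)) = ∑ i, x i * ∏ j : ↥J, φ i j (y j) := by
    intro y
    rw [hψsum]
    refine Finset.sum_congr rfl fun i _ => ?_
    have h1 : ∏ j ∈ Jᶜ, (f i j).coeff (wd y j) = ∏ j ∈ Jᶜ, (f i j).coeff (a j) := by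
      refine Finset.prod_congr rfl fun j hj => ?_
      have hj' : j ∉ J := Finset.mem_compl.1 hj
      simp only [wd, dif_neg hj']
    have h2 : ∏ j ∈ J, (f i j).coeff (wd y j) = ∏ j : ↥J, φ i j (y j) := by
      rw [← Finset.prod_coe_sort J]
      refine Finset.prod_congr rfl fun j _ => ?_
      simp only [wd, φ, dif_pos j.2, Subtype.coe_eta]
    simp only [QuasiPoly.col, x]
    rw [← Finset.prod_mul_prod_compl J (fun j => (f i j).coeff (wd y j)), h1, h2]
    ring
  -- every corner other than the all-`true` corner is strictly higher than `a`, hence killed by `ψ`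
  have hzero : ∀ y : ↥J → Bool, y ≠ (fun _ => true) → ∑ i, x i * ∏ j : ↥J, φ i j (y j) = 0 := by
    intro y hy
    rw [← hT y]
    have hwa : wd y ≠ a := by
      intro heq
      obtain ⟨j, hj⟩ := Function.ne_iff.1 hy
      have hyj : y j = false := by simpa using hj
      have h1 := congrFun heq j
      simp only [wd, dif_pos j.2, Subtype.coe_eta, hyj, cond_false] at h1
      exact (Finset.mem_filter.1 j.2).2 h1.symm
    have hle : ε * QuasiPoly.Xf a + lam * QuasiPoly.Yf a ≤ ε * QuasiPoly.Xf (wd y) + lam * QuasiPoly.Yf (wd y) := by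
      rw [hadd a, hadd (wd y)]
      refine Finset.sum_le_sum fun j _ => ?_
      by_cases hj : j ∈ J
      · simp only [wd, dif_pos hj]
        rcases Bool.eq_false_or_eq_true (y ⟨j, hj⟩) with hy' | hy'
        · rw [hy']; exact le_rfl
        · rw [hy']; exact hτ j (a j) (haA' j)
      · simp only [wd, dif_neg hj]
        exact le_rfl
    have hne : ε * QuasiPoly.Xf a + lam * QuasiPoly.Yf a ≠ ε * QuasiPoly.Xf (wd y) + lam * QuasiPoly.Yf (wd y) :=
      fun heq => hwa (hinj (hwdA y) haA heq.symm)
    exact hψkill (wd y) (hwdA y) (lt_of_le_of_ne hle hne)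
  -- the all-`true` corner is `a` itself and survives
  have hwtrue : wd (fun _ => true) = a := by
    funext j
    by_cases hj : j ∈ J
    · simp only [wd, dif_pos hj, cond_true]
    · simp only [wd, dif_neg hj]
  have htop : ∑ i, x i * ∏ j : ↥J, φ i j true ≠ 0 := by
    have h := (hT (fun _ => true)).symm
    simp only [hwtrue] at h
    rw [h]
    exact hψa
  -- torus: every term is alive at the `false` (= top) corner
  have hstruct : ∀ i, x i = 0 ∨ (∀ j : ↥J, φ i j false ≠ 0) ∨ (∃ j : ↥J, φ i j true = 0) :=
    fun i => Or.inr (Or.inl fun j => htorus i j (τ j) (hτA j))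
  have hlt := Summit.ValiantsHypothesis.Theorems.DissociatedFixedK.thickness_of_annihilator x φ hstruct hzero htop
  rw [Fintype.card_coe] at hlt
  exact Nat.succ_le_of_lt hlt

end Summit.ValiantsHypothesis.ValiantsHypothesis.Theorems.NewtonUnitEquationsDissociatedUniform
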